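import Literature.AnabelianGeometry.EtaleTheta.SettingModelMuTwo
import Literature.AnabelianGeometry.EtaleTheta.SettingModelInversion
import Mathlib.GroupTheory.SemidirectProduct
import HarnessLib

/-!
# A model of [EtTh] Def. 1.7 in which `ε_±` IS the inversion: `Π^tp_C := Π^tp_X ⋊_ι ℤ/2` over the root model

S. Mochizuki, *The étale theta function and its Frobenioid-theoretic manifestations*, Publ. RIMS **45** (2009) [EtTh],
Def. 1.7 p. 27 (PRIMS p. 253): «`C^log` … the quotient of `X^log` by the natural action of `±1`», «`Ẍ^log → X^log` … the
Galois covering of degree `4` determined by the multiplication by `2` map», «`Gal(Ẍ^log/C^log) ≅ (ℤ/2ℤ)³`», «`ε_± ∈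
Gal(Ẍ/C)`» (lifting `−1`); §2 p. 36 «`ι` … “multiplication by `−1`”»; Prop. 2.2 (i) p. 37. [cite: MochizukiEtTh2009, Def 1.7 p.27]

Cell abc-iut, seat abc-iut-w5-d072 (gen 3; (R1) ι-datum custody, GAP G-w4d010-2 / D-G-w4d010-2h). abc-iut-L2-t1's
inhabitant `MuTwoSetting.model p` (`SettingModelMuTwo.lean`, p421643) of the Def. 1.7 interface `MuTwoSetting`
(`ConstantMultipleRigidity.lean`) takes `Π^tp_C := Π^tp_X × ℤ/2`, so its `ε_±` is CENTRAL and conjugation by `ε_±` is the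
identity of `Π^tp_X` (abc-iut-w4-d014, STATUS 04:35:03Z, P1): there the (R1) facets «`ι̂ ≡ −1` on `Δ_X^ab`» / «`ι` reverses `Z`»
FAIL for `ι :=` (`ε_±`-conjugation). This file builds a SECOND inhabitant over the SAME root `ThetaSetting.model p` in which
`ε_±` acts on `Π^tp_X` as the pointed inversion `SettingModel.inversion p` (`SettingModelInversion.lean`: `σ × id` on
`F₂ × Γ`, `a ↦ a⁻¹`, `b ↦ b⁻¹`):

* `inversionAction p : ℤ/2 →* MulAut Π^tp_X` (generator `↦ ι`; `ι² = 1`) and the discrete type synonym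
  `PiCInv p := Π^tp_X ⋊_ι ℤ/2` (Mathlib `SemidirectProduct`); `Π^tp_X ↪ Π^tp_C` is `SemidirectProduct.inl` (normal — the
  kernel of `rightHom` — of index `2`, open), **`ε_± := inr(1̄)`**, so that **`ε_± · x · ε_±⁻¹ = ι(x)` on `Π^tp_X`**
  (`epsPM_conj_inl`, Mathlib `SemidirectProduct.inl_aut`);
* `Π^tp_Ẍ := Xdd p` REUSED from `SettingModelMuTwo.lean` (words of even `a`-, `b`-exponent `× Γ`; index `4`, `⊇ Π^tp_Ÿ`
  BY NAME); it is normal in the semidirect product because it is normal in `Π^tp_X` and `ι`-STABLE (`inversionM_mem_Xdd_iff`: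
  `ι` negates the parity character `Heis.xyMod 2 ∘ heisHom`), and contains all squares since `(n, ε)² = (n · ι(n), 1)` and
  the parity character of `n · ι(n)` is `χ(n) · χ(n)⁻¹ = 1` (`mul_inversionM_mem_Xdd`); `ε_μ := inl(b)`, `ε_Z := inl(a)`
  admissible — all as in abc-iut-L2-t1's model;
* **`MuTwoSetting.inversionModel p : MuTwoSetting p`**, `inversionModel_toThetaSetting = ThetaSetting.model p` (`rfl`),
  the guard `inversionModel_isEtThOrigin`, `inversionModel_isAdmissibleEpsZ`, `isInducing_inclX_inversionModel` (the L6
  binder (R1d) `hind`, trivially at a discrete model);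
* headline `MuTwoSetting.exists_epsPM_realises_inversion`: **the Def. 1.7 interface, the origin guard, an admissible
  `ε_Z`, (R1d) `IsInducing inclX`, AND a topological automorphism `ι` of `Π^tp_X` REALISING `ε_±`-conjugation
  (`inclX (ι x) = ε_± · inclX x · ε_±⁻¹`) which is a nontrivial involution over `G_K` with (R1b′) `ι(Δ^tp_X) = Δ^tp_X`,
  (R1c) `toZ ∘ ι = toZ⁻¹` and (R1e′) «`ι̂ ≡ −1` on `Δ_X^ab`» are JOINTLY SATISFIABLE** — the positive companion of P1. The
  identification with the L6 datum `EtaleThetaDataOfSetting.epsPMInversion` (= this `ι`) is a three-line corollary left to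
  a proof-only `Literature/IUT/HodgeArakelov` file (layering).

HONEST LIMITS: consistency evidence only; semi-synthetic and degenerate along the tempered topology (everything discrete;
`Π^tp_X = F₂ × G_{ℚ_p}` is a direct product, so — as for every structure over this root — Kummer-level data stay vacuous,
abc-iut-L2-lead R77); NOT the tempered fundamental group of an orbicurve. Under the DEFS-FREEZE this is a class (b)
CONSTRUCTION of the frozen interface (no interface clause touched). Instances only on the NEW synonym `PiCInv`; no Prop
facts; nothing of [EtTh] is asserted; no side is taken on [IUTchIII] Cor. 3.12; typed ≠ proved; instantiated ≠ endorsed.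
-/

noncomputable section

namespace Literature.AnabelianGeometry.EtaleTheta.SettingModel

open Literature.AnabelianGeometry.SemiGraphs
open _root_.Topology

variable (p : ℕ) [Fact p.Prime]

/-! ### `ι`-stability of `Π^tp_Ẍ` and the square law -/

/-- The parity character `Π^tp_X → Δ = F₂ → Heis ℤ → ℤ/2 × ℤ/2` (`(a, b)`-exponents mod `2`), whose kernel is
`Π^tp_Ẍ = Xdd p`. [cite: MochizukiEtTh2009, Def 1.7 p.27] -/
def parity : PiTp p →* Multiplicative (ZMod 2 × ZMod 2) :=
  (((Heis.xyMod 2).comp heisHom).comp Del.val).comp (MonoidHom.fst Del (Gam p))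

/-- `x ∈ Π^tp_Ẍ ↔ parity x = 1`. [cite: MochizukiEtTh2009, Def 1.7 p.27] -/
theorem mem_Xdd_iff_parity (x : PiTp p) : x ∈ Xdd p ↔ parity p x = 1 := by
  rw [Xdd, Subgroup.mem_prod]
  simp only [Subgroup.mem_top, and_true, Subgroup.mem_comap, deltaXdd, heisMod, MonoidHom.mem_ker]
  rfl

/-- `ι` NEGATES the parity character: `parity (ι x) = (parity x)⁻¹`. [cite: MochizukiEtTh2009, Prop 2.2 (i) p.37] -/
theorem parity_inversionM (x : PiTp p) : parity p (inversionM p x) = (parity p x)⁻¹ := by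
  change ((Heis.xyMod 2).comp heisHom) (Del.val (Del.inv x.1)) = (((Heis.xyMod 2).comp heisHom) (Del.val x.1))⁻¹
  rw [Del.val_inv, hom_invGenHom]

/-- **`Π^tp_Ẍ` is `ι`-stable**: `x ∈ Π^tp_Ẍ ↔ ι x ∈ Π^tp_Ẍ`. [cite: MochizukiEtTh2009, Def 1.7 p.27] -/
theorem inversionM_mem_Xdd_iff (x : PiTp p) : inversionM p x ∈ Xdd p ↔ x ∈ Xdd p := by
  rw [mem_Xdd_iff_parity, mem_Xdd_iff_parity, parity_inversionM, inv_eq_one]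

/-- **`x · ι(x) ∈ Π^tp_Ẍ`** for every `x ∈ Π^tp_X` (the parity of `x · ι(x)` is `χ(x)·χ(x)⁻¹ = 1`) — the square law
`(x, ε_±)² = (x · ι x, 1) ∈ Π^tp_Ẍ` of `Gal(Ẍ/C) ≅ (ℤ/2)³`. [cite: MochizukiEtTh2009, Def 1.7 p.27] -/
theorem mul_inversionM_mem_Xdd (x : PiTp p) : x * inversionM p x ∈ Xdd p := by
  rw [mem_Xdd_iff_parity, map_mul, parity_inversionM, mul_inv_cancel]

/-- `x · x ∈ Π^tp_Ẍ` for every `x ∈ Π^tp_X`. [cite: MochizukiEtTh2009, Def 1.7 p.27] -/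
theorem mul_self_mem_Xdd (x : PiTp p) : x * x ∈ Xdd p :=
  ⟨by change Del.val (x.1 * x.1) ∈ deltaXdd; rw [map_mul]; exact mul_self_mem_deltaXdd _, trivial⟩

/-- `Π^tp_Ẍ` is normal in `Π^tp_X`. [cite: MochizukiEtTh2009, Def 1.7 p.27] -/
theorem Xdd_normal : (Xdd p).Normal := by
  rw [Xdd]
  haveI : (heisMod 2).Normal := inferInstanceAs (Heis.xyMod 2).ker.Normal
  haveI : deltaXdd.Normal := Subgroup.Normal.comap inferInstance _
  haveI : (deltaXdd.comap Del.val).Normal := Subgroup.Normal.comap inferInstance _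
  infer_instance

/-! ### The action of `ℤ/2` on `Π^tp_X` through `ι` and the semidirect product `Π^tp_C := Π^tp_X ⋊_ι ℤ/2` -/

/-- `ι ∘ ι = 1` in `Aut(Π^tp_X)`. [cite: MochizukiEtTh2009, §2 p.36] -/
theorem inversionM_mul_inversionM :
    (inversionM p).toMulEquiv * (inversionM p).toMulEquiv = (1 : MulAut (PiTp p)) :=
  MulEquiv.ext fun g => inversion_inversion p g

/-- **The action `ℤ/2 → Aut(Π^tp_X)`, generator `↦ ι`** (well defined since `ι² = 1`). [cite: MochizukiEtTh2009, Def 1.7 p.27] -/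
def inversionAction : Multiplicative (ZMod 2) →* MulAut (PiTp p) where
  toFun z := if z = 1 then 1 else (inversionM p).toMulEquiv
  map_one' := if_pos rfl
  map_mul' a b := by
    have key : ∀ z : Multiplicative (ZMod 2), z = 1 ∨ z = Multiplicative.ofAdd 1 := by decide
    have hne : (Multiplicative.ofAdd (1 : ZMod 2)) ≠ 1 := by decide
    have hsq : Multiplicative.ofAdd (1 : ZMod 2) * Multiplicative.ofAdd 1 = 1 := by decide
    rcases key a with rfl | rfl <;> rcases key b with rfl | rfl
    · simp
    · simp [hne]
    · simp [hne]
    · rw [hsq, if_pos rfl, if_neg hne, inversionM_mul_inversionM]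

/-- The generator acts by `ι`. [cite: MochizukiEtTh2009, Def 1.7 p.27] -/
theorem inversionAction_ofAdd_one :
    inversionAction p (Multiplicative.ofAdd 1) = (inversionM p).toMulEquiv := by
  change (if Multiplicative.ofAdd (1 : ZMod 2) = 1 then (1 : MulAut (PiTp p)) else (inversionM p).toMulEquiv) = _
  rw [if_neg (by decide)]

/-- `φ(z)(x)` is `x` or `ι x`; in either case `x · φ(z)(x) ∈ Π^tp_Ẍ`. [cite: MochizukiEtTh2009, Def 1.7 p.27] -/
theorem mul_inversionAction_mem_Xdd (z : Multiplicative (ZMod 2)) (x : PiTp p) :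
    x * inversionAction p z x ∈ Xdd p := by
  have key : ∀ z : Multiplicative (ZMod 2), z = 1 ∨ z = Multiplicative.ofAdd 1 := by decide
  rcases key z with rfl | rfl
  · rw [map_one]
    exact mul_self_mem_Xdd p x
  · rw [inversionAction_ofAdd_one]
    exact mul_inversionM_mem_Xdd p x

/-- `φ(z)` preserves `Π^tp_Ẍ`. [cite: MochizukiEtTh2009, Def 1.7 p.27] -/
theorem inversionAction_mem_Xdd (z : Multiplicative (ZMod 2)) {x : PiTp p} (hx : x ∈ Xdd p) :
    inversionAction p z x ∈ Xdd p := by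
  have key : ∀ z : Multiplicative (ZMod 2), z = 1 ∨ z = Multiplicative.ofAdd 1 := by decide
  rcases key z with rfl | rfl
  · rw [map_one]
    exact hx
  · rw [inversionAction_ofAdd_one]
    exact (inversionM_mem_Xdd_iff p x).mpr hx

/-- **`Π^tp_C := Π^tp_X ⋊_ι ℤ/2`** — the model of the tempered fundamental group of `C^log = X^log/{±1}` in which the
non-identity coset acts on `Π^tp_X` by the inversion `ι` (a DISCRETE type synonym of Mathlib's semidirect product).
[cite: MochizukiEtTh2009, Def 1.7 p.27] -/
def PiCInv : Type := PiTp p ⋊[inversionAction p] Multiplicative (ZMod 2)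

/-- [folklore] -/ instance : Group (PiCInv p) :=
  inferInstanceAs (Group (PiTp p ⋊[inversionAction p] Multiplicative (ZMod 2)))
/-- [folklore] -/ instance : TopologicalSpace (PiCInv p) := ⊥
/-- [folklore] -/ instance : DiscreteTopology (PiCInv p) := ⟨rfl⟩

/-- `Π^tp_X ↪ Π^tp_C`: the normal factor of the semidirect product. [cite: MochizukiEtTh2009, Def 1.7 p.27] -/
def inclInv : PiTp p →* PiCInv p := SemidirectProduct.inl

/-- The quotient `Π^tp_C ↠ ℤ/2 = Gal(X/C)`. [cite: MochizukiEtTh2009, Def 1.7 p.27] -/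
def toGalXC : PiCInv p →* Multiplicative (ZMod 2) := SemidirectProduct.rightHom

/-- **`ε_± := (1, 1̄)`**, the generator of the complement `ℤ/2` — it lifts `−1`. [cite: MochizukiEtTh2009, Def 1.7 p.27] -/
def epsPMInv : PiCInv p := SemidirectProduct.inr (Multiplicative.ofAdd 1)

/-- `Π^tp_X = Ker(Π^tp_C ↠ ℤ/2)`. [cite: MochizukiEtTh2009, Def 1.7 p.27] -/
theorem range_inclInv : (inclInv p).range = (toGalXC p).ker :=
  SemidirectProduct.range_inl_eq_ker_rightHom

/-- `Π^tp_C ↠ ℤ/2` is onto. [cite: MochizukiEtTh2009, Def 1.7 p.27] -/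
theorem toGalXC_surjective : Function.Surjective (toGalXC p) := SemidirectProduct.rightHom_surjective

/-- **`ε_± · x · ε_±⁻¹ = ι(x)` on `Π^tp_X`**: conjugation by `ε_±` IS the pointed inversion (Mathlib
`SemidirectProduct.inl_aut`). [cite: MochizukiEtTh2009, §2 p.36] -/
theorem epsPM_conj_inl (x : PiTp p) :
    epsPMInv p * inclInv p x * (epsPMInv p)⁻¹ = inclInv p (inversionM p x) := by
  have h := SemidirectProduct.inl_aut (φ := inversionAction p) (Multiplicative.ofAdd (1 : ZMod 2)) x
  rw [inversionAction_ofAdd_one] at h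
  change epsPMInv p * inclInv p x * (epsPMInv p)⁻¹ = SemidirectProduct.inl ((inversionM p).toMulEquiv x)
  rw [h, epsPMInv, map_inv]
  rfl

/-- A subgroup of `Π^tp_X` that is normal and `φ`-stable has normal image in the semidirect product. [folklore] -/
private theorem map_inl_normal_of_stable {N G : Type*} [Group N] [Group G] {φ : G →* MulAut N} (H : Subgroup N)
    (hH : H.Normal) (hφ : ∀ (g : G) {n : N}, n ∈ H → φ g n ∈ H) :
    (H.map (SemidirectProduct.inl : N →* N ⋊[φ] G)).Normal := by
  refine ⟨?_⟩
  rintro _ ⟨h, hh, rfl⟩ y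
  refine ⟨y.left * φ y.right h * y.left⁻¹, hH.conj_mem _ (hφ y.right hh) y.left, ?_⟩
  rw [map_mul, map_mul, map_inv, SemidirectProduct.inl_aut]
  conv_rhs => rw [← SemidirectProduct.inl_left_mul_inr_right y]
  rw [map_inv, mul_inv_rev]
  group

/-- The square of `(x, z)` is `(x · φ(z)(x), 1)` (`z² = 1` in `ℤ/2`). [cite: MochizukiEtTh2009, Def 1.7 p.27] -/
theorem sq_eq_inl (g : PiCInv p) :
    g * g = inclInv p (SemidirectProduct.left g * inversionAction p (SemidirectProduct.right g) (SemidirectProduct.left g)) := by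
  have h2 : ∀ t : Multiplicative (ZMod 2), t * t = 1 := by decide
  refine SemidirectProduct.ext ?_ ?_
  · rfl
  · change SemidirectProduct.right g * SemidirectProduct.right g = 1
    exact h2 _

/-! ### The inhabitant -/

/-- **The inversion model of [EtTh] Def. 1.7.** An inhabitant of `MuTwoSetting p` over the root `ThetaSetting.model p`
with `Π^tp_C := Π^tp_X ⋊_ι ℤ/2`, `Π^tp_Ẍ := Xdd p` (even exponents `× Γ`), `ε_μ := b`, `ε_± := (1, 1̄)` — so that
conjugation by `ε_±` on `Π^tp_X` is the inversion `a ↦ a⁻¹`, `b ↦ b⁻¹`. Semi-synthetic; consistency evidence only.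
[cite: MochizukiEtTh2009, Def 1.7 p.27] -/
abbrev _root_.Literature.AnabelianGeometry.EtaleTheta.MuTwoSetting.inversionModel : MuTwoSetting p where
  toThetaSetting := ThetaSetting.model p
  sqrtqX_mem_K := (MuTwoSetting.model p).sqrtqX_mem_K
  GtpC := PiCInv p
  inclX := inclInv p
  continuous_inclX := continuous_of_discreteTopology
  injective_inclX := SemidirectProduct.inl_injective
  isOpen_range_inclX := isOpen_discrete _
  range_inclX_normal := by
    rw [range_inclInv]
    infer_instance
  index_range_inclX := by
    rw [range_inclInv, Subgroup.index_ker, MonoidHom.range_eq_top.mpr (toGalXC_surjective p), Subgroup.card_top]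
    change Nat.card (ZMod 2) = 2
    exact Nat.card_zmod 2
  GtpXdd := Xdd p
  index_GtpXdd := (MuTwoSetting.model p).index_GtpXdd
  map_GtpXdd_normal :=
    map_inl_normal_of_stable (Xdd p) (Xdd_normal p) (fun z _ hx => inversionAction_mem_Xdd p z hx)
  sq_mem_GtpXdd g := by
    rw [sq_eq_inl]
    exact ⟨_, mul_inversionAction_mem_Xdd p _ _, rfl⟩
  GtpYdd_le_GtpXdd := (MuTwoSetting.model p).GtpYdd_le_GtpXdd
  epsMu := inclInv p (Del.ofF₂ (FreeGroup.of 1), 1)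
  epsMu_mem := ⟨_, rfl⟩
  epsMu_not_mem := by
    rintro ⟨y, hy, hyy⟩
    have h := SemidirectProduct.inl_injective hyy
    subst h
    exact of_one_not_mem_deltaXdd hy.1
  epsPM := epsPMInv p
  epsPM_not_mem := by
    rintro ⟨y, hy⟩
    have h := congrArg (toGalXC p) hy
    change SemidirectProduct.rightHom (SemidirectProduct.inl y) =
      SemidirectProduct.rightHom (SemidirectProduct.inr (Multiplicative.ofAdd 1)) at h
    rw [SemidirectProduct.rightHom_inl, SemidirectProduct.rightHom_inr] at h
    exact absurd h (by decide)

/-- The inversion model sits over the root model. [cite: MochizukiEtTh2009, Def 1.7 p.27] -/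
theorem _root_.Literature.AnabelianGeometry.EtaleTheta.MuTwoSetting.inversionModel_toThetaSetting :
    (MuTwoSetting.inversionModel p).toThetaSetting = ThetaSetting.model p := rfl

/-- … hence satisfies the guard `IsEtThOrigin`. [cite: MochizukiEtTh2009, §1 p.12] -/
theorem _root_.Literature.AnabelianGeometry.EtaleTheta.MuTwoSetting.inversionModel_isEtThOrigin :
    (MuTwoSetting.inversionModel p).toThetaSetting.IsEtThOrigin :=
  ThetaSetting.model_isEtThOrigin p

/-- `ε_±` of the inversion model is the generator of the complement. [cite: MochizukiEtTh2009, Def 1.7 p.27] -/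
theorem _root_.Literature.AnabelianGeometry.EtaleTheta.MuTwoSetting.inversionModel_epsPM :
    (MuTwoSetting.inversionModel p).epsPM = epsPMInv p := rfl

/-- `inclX` of the inversion model is `inl`. [cite: MochizukiEtTh2009, Def 1.7 p.27] -/
theorem _root_.Literature.AnabelianGeometry.EtaleTheta.MuTwoSetting.inversionModel_inclX (x : PiTp p) :
    (MuTwoSetting.inversionModel p).inclX x = inclInv p x := rfl

/-- **`ε_± · inclX x · ε_±⁻¹ = inclX (ι x)`** in the inversion model: `ε_±`-conjugation on `Π^tp_X` is the pointed inversion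
`SettingModel.inversion p`. [cite: MochizukiEtTh2009, §2 p.36] -/
theorem _root_.Literature.AnabelianGeometry.EtaleTheta.MuTwoSetting.inversionModel_epsPM_conj (x : PiTp p) :
    (MuTwoSetting.inversionModel p).epsPM * (MuTwoSetting.inversionModel p).inclX x *
        (MuTwoSetting.inversionModel p).epsPM⁻¹ =
      (MuTwoSetting.inversionModel p).inclX (inversion p x) :=
  epsPM_conj_inl p x

/-- **`ε_Z := a` is admissible** in the inversion model (`a ∉ Π^tp_Ẍ`, `a·b⁻¹ ∉ Π^tp_Ẍ`). [cite: MochizukiEtTh2009, Def 1.7 p.27] -/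
theorem _root_.Literature.AnabelianGeometry.EtaleTheta.MuTwoSetting.inversionModel_isAdmissibleEpsZ :
    (MuTwoSetting.inversionModel p).IsAdmissibleEpsZ (inclInv p (Del.ofF₂ (FreeGroup.of 0), 1)) := by
  refine ⟨⟨_, rfl⟩, ?_, ?_⟩
  · rintro ⟨y, hy, hyy⟩
    have h := SemidirectProduct.inl_injective hyy
    subst h
    exact of_zero_not_mem_deltaXdd hy.1
  · change inclInv p (Del.ofF₂ (FreeGroup.of 0), 1) * (inclInv p (Del.ofF₂ (FreeGroup.of 1), 1))⁻¹ ∉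
      (Xdd p).map (inclInv p)
    rw [← map_inv, ← map_mul]
    rintro ⟨y, hy, hyy⟩
    have h := SemidirectProduct.inl_injective hyy
    subst h
    exact of_zero_mul_of_one_inv_not_mem_deltaXdd hy.1

/-- An injective map between DISCRETE spaces is inducing. [folklore] -/
private theorem isInducing_of_discrete {X Y : Type*} [TopologicalSpace X] [DiscreteTopology X] [TopologicalSpace Y]
    [DiscreteTopology Y] {f : X → Y} (hf : Function.Injective f) : IsInducing f := by
  rw [isInducing_iff_nhds]
  intro x
  simp only [nhds_discrete]
  rw [Filter.comap_pure, ← Set.image_singleton, hf.preimage_image, Filter.principal_singleton]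

/-- **(R1d) at the inversion model**: `inclX : Π^tp_X ↪ Π^tp_C` induces the topology of `Π^tp_X` (trivially: both discrete)
— the binder `hind` of the L6 datum `EtaleThetaDataOfSetting.epsPMInversion`. [cite: MochizukiEtTh2009, Def 1.7 p.27] -/
theorem _root_.Literature.AnabelianGeometry.EtaleTheta.MuTwoSetting.isInducing_inclX_inversionModel :
    IsInducing (MuTwoSetting.inversionModel p).inclX :=
  isInducing_of_discrete SemidirectProduct.inl_injective

/-- **(R1d) at abc-iut-L2-t1's product model too**: `inclX : Π^tp_X ↪ Π^tp_X × ℤ/2` induces the topology of `Π^tp_X`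
(both discrete) — so the binder `hind` is available at BOTH Def. 1.7 models. [cite: MochizukiEtTh2009, Def 1.7 p.27] -/
theorem _root_.Literature.AnabelianGeometry.EtaleTheta.MuTwoSetting.isInducing_inclX_model :
    IsInducing (MuTwoSetting.model p).inclX :=
  isInducing_of_discrete (MuTwoSetting.model p).injective_inclX

/-! ### Joint satisfiability: Def. 1.7 with `ε_±` a genuine inversion -/

/-- **[EtTh] Def. 1.7's interface admits a model in which `ε_±` acts on `Π^tp_X` as a genuine inversion.** There is
`M : MuTwoSetting p` with the origin guard, an admissible `ε_Z`, `inclX` inducing (R1d), and a topological automorphism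
`ι` of `Π^tp_X` REALISING conjugation by `ε_±` (`inclX (ι x) = ε_± · inclX x · ε_±⁻¹`) which is a nontrivial involution over
`G_K` satisfying (R1b′) `ι(Δ^tp_X) = Δ^tp_X`, (R1c) `toZ (ι x) = (toZ x)⁻¹` and (R1e′) «`ι̂ ≡ −1` on `Δ_X^ab`»
(`∀ g ∈ Δ_X, ι̂ g · g ∈ closure ⁅Δ_X, Δ_X⁆`) — witness `MuTwoSetting.inversionModel p` with `ι := SettingModel.inversion p`
(`SettingModelInversion.lean`). The positive companion of the observation that these facets fail for `MuTwoSetting.model p`.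
[cite: MochizukiEtTh2009, Prop 2.2 (i) p.37] -/
theorem _root_.Literature.AnabelianGeometry.EtaleTheta.MuTwoSetting.exists_epsPM_realises_inversion :
    ∃ M : MuTwoSetting p, M.toThetaSetting.IsEtThOrigin ∧ (∃ εZ : M.GtpC, M.IsAdmissibleEpsZ εZ) ∧
      IsInducing M.inclX ∧
      ∃ ι : M.PiTemp ≃ₜ* M.PiTemp, (∀ x, M.inclX (ι x) = M.epsPM * M.inclX x * M.epsPM⁻¹) ∧
        ι ≠ ContinuousMulEquiv.refl M.PiTemp ∧ (∀ g, ι (ι g) = g) ∧ (∀ g, M.aug (ι g) = M.aug g) ∧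
        M.DeltaTemp.map ι.toMulEquiv.toMonoidHom = M.DeltaTemp ∧ (∀ g, M.toZ (ι g) = (M.toZ g)⁻¹) ∧
        ∀ g ∈ M.DeltaHat, M.completionAut ι g * g ∈ (⁅M.DeltaHat, M.DeltaHat⁆).topologicalClosure :=
  ⟨MuTwoSetting.inversionModel p, MuTwoSetting.inversionModel_isEtThOrigin p,
    ⟨_, MuTwoSetting.inversionModel_isAdmissibleEpsZ p⟩, MuTwoSetting.isInducing_inclX_inversionModel p,
    inversion p, fun x => (epsPM_conj_inl p x).symm, inversion_ne_refl p, inversion_inversion p, aug_inversion p,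
    map_deltaTemp_inversion p, toZ_inversion p, inversion_hinv p⟩

end Literature.AnabelianGeometry.EtaleTheta.SettingModel

end
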